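import Summits.HodgeConjecture.CorCM.GaloisQuaternionCyclicLift
import Mathlib.GroupTheory.SpecificGroups.Quaternion
import HarnessLib

/-!
# `Q₈ × C₁₃`: a BALANCED-SET certificate (balanced over `C₁₃`), and `Q₈ × C₁₃ ↪ Gal(K/ℚ)` through `c` with `C₁₃` normal ⟹ BAD

COR-CM (cell `pub-hodgecm2`), binder seat b04 (gen 39), count-neutral own lane «Galois-CM-type classification» (blanket
`CorCM/GaloisQuaternion*`).  KERNEL ONLY: theorems (`decide` certificates); no definition, no named fact, no `sorry`.  `HC_CM` is
neither used nor claimed.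

`Q₈ × C₁₃` is BAD (gen 28, `CorCM/GaloisQuaternionCyclicPrimeNormPairs`, by a `μ₄`-norm pair, `ord₁₃ 2 = 12` even).  For gen 39's
certificate LIFT (`CorCM/GaloisBalancedCertificateLift`, `CorCM/GaloisQuaternionCyclicLift`) a certificate in gen 20's balanced-set
format is needed; here is one (seat's two-sheet meet-in-the-middle, `scratch-g39/q2n/mitm.c` with `m = 2`, `p = 13`, and the
shifted-difference annihilator `b = (σ(v)γ, uγ)`, `γ = 1 − ξ`, of the seat notes — `scratch-g39/q2n/findD.py`): a primitive CM set
`T₁` (52 elements) and a balanced `D₁` of `16` elements moved by `c = (a², 1)` whose multiset of first coordinates is `c`-invariant.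
Hence (gen 39 `exists_simple_degenerate_of_quaternion_cyclic_certificate`): ANY Galois CM field whose group contains `A, X, u` with
`ord A = 4`, `X² = A² = c`, `XAX⁻¹ = A⁻¹`, `ord u = 13`, `[A,u] = [X,u] = 1`, `⟨u⟩ ◁ Gal` is BAD — in particular the shapes Q× and QK of
order `2ⁿ·13` (`CorCM/GaloisOddPrimeShapesQuaternionBad`).

References: Shimura (1998), §6.2 Thm. 3, §8.2 Prop. 26 [cite: Shimura1998]; Gordon (1999), Thm. 6.4, §9.3
[cite: Gordon1999HodgeAVSurvey].
-/

noncomputable section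

open CategoryTheory CategoryTheory.Limits NumberField
open scoped BigOperators

namespace Summit.HodgeConjecture.CorCM.GaloisModels

open Literature.NumberTheory.ComplexMultiplication
open Literature.AlgebraicGeometry.Motives (AbelianVariety CMType)
open Literature.AlgebraicGeometry.HodgeTheory
open Literature.AlgebraicGeometry.ComplexMultiplication (IsCMTypeRealisation)
open Literature.AlgebraicGeometry.Pohlmann1968
open Literature.Barriers.HodgeConjecture (divisorClassesSpan)
open Summit.HodgeConjecture.CorCM.GaloisRank
open QuaternionGroup

variable {K : Type} [Field K] [NumberField K] [IsCMField K]

set_option maxRecDepth 8000 in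
/-- **`Q₈ × C₁₃ ↪ Gal(K/ℚ)` through `c`, `C₁₃` normal ⟹ BAD**: `ord A = 4`, `X² = A² = c`, `XAX⁻¹ = A⁻¹`, `ord u = 13`,
`[A,u] = [X,u] = 1`, `⟨u⟩ ◁ Gal` — balanced-set certificate of `52 + 16` elements for `Q₈ × C₁₃`, balanced over `C₁₃`, lifted.
[cite: Shimura1998, §6.2 Thm. 3 and §8.2 Prop. 26] [cite: Gordon1999HodgeAVSurvey, Thm. 6.4 and §9.3] -/
theorem exists_simple_degenerate_of_quaternionEight_cyclicThirteen_subgroup [IsGalois ℚ K] {A X u : K ≃ₐ[ℚ] K}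
    (hA : orderOf A = 4) (hX : X * X = A ^ 2) (hXA : X * A * X⁻¹ = A⁻¹)
    (hc : A ^ 2 = (IsCMField.complexConj K).restrictScalars ℚ) (hu : orderOf u = 13) (hAu : A * u = u * A)
    (hXu : X * u = u * X) (hnorm : (Subgroup.zpowers u).Normal) :
    ∃ (Φ : CMType K) (φ₀ : K →+* ℂ) (A : AbelianVariety ℂ) (ι : 𝓞 K →+* End A)
      (θ : K →+* Module.End ℂ (complexBetti A.X 1)),
      IsPrimitive (ℂ ≃+* ℂ) Φ.1 φ₀ ∧ ¬ IsNondegenerate Φ ∧ IsCMTypeRealisation Φ A ι θ ∧ A.IsSimple ∧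
      A.dim = Module.finrank ℚ K / 2 ∧
      ∃ n p : ℕ, ∃ x : complexBetti (⨁ fun _ : Fin n => A).X (2 * p), IsRationalClass x ∧
        IsOfHodgeType (⨁ fun _ : Fin n => A).dim (⨁ fun _ : Fin n => A).X (2 * p) p p x ∧
        x ∉ divisorClassesSpan (⨁ fun _ : Fin n => A).X (⨁ fun _ : Fin n => A).dim p :=
  exists_simple_degenerate_of_quaternion_cyclic_certificate (m := 2) (p := 13) le_rfl (by decide) (by decide) (by decide)
    hA hX hXA hc hu hAu hXu hnorm
    {(a 0, Multiplicative.ofAdd 5), (a 0, Multiplicative.ofAdd 6), (a 1, Multiplicative.ofAdd 0),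
      (a 1, Multiplicative.ofAdd 2), (a 1, Multiplicative.ofAdd 4), (a 1, Multiplicative.ofAdd 5),
      (a 1, Multiplicative.ofAdd 7), (a 1, Multiplicative.ofAdd 8), (a 1, Multiplicative.ofAdd 9),
      (a 1, Multiplicative.ofAdd 10), (a 1, Multiplicative.ofAdd 11), (a 1, Multiplicative.ofAdd 12),
      (a 2, Multiplicative.ofAdd 0), (a 2, Multiplicative.ofAdd 1), (a 2, Multiplicative.ofAdd 2),
      (a 2, Multiplicative.ofAdd 3), (a 2, Multiplicative.ofAdd 4), (a 2, Multiplicative.ofAdd 7),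
      (a 2, Multiplicative.ofAdd 8), (a 2, Multiplicative.ofAdd 9), (a 2, Multiplicative.ofAdd 10),
      (a 2, Multiplicative.ofAdd 11), (a 2, Multiplicative.ofAdd 12), (a 3, Multiplicative.ofAdd 1),
      (a 3, Multiplicative.ofAdd 3), (a 3, Multiplicative.ofAdd 6), (xa 0, Multiplicative.ofAdd 1),
      (xa 0, Multiplicative.ofAdd 2), (xa 0, Multiplicative.ofAdd 4), (xa 0, Multiplicative.ofAdd 6),
      (xa 0, Multiplicative.ofAdd 7), (xa 0, Multiplicative.ofAdd 8), (xa 0, Multiplicative.ofAdd 9),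
      (xa 0, Multiplicative.ofAdd 10), (xa 0, Multiplicative.ofAdd 11), (xa 0, Multiplicative.ofAdd 12),
      (xa 1, Multiplicative.ofAdd 2), (xa 1, Multiplicative.ofAdd 3), (xa 1, Multiplicative.ofAdd 4),
      (xa 1, Multiplicative.ofAdd 5), (xa 1, Multiplicative.ofAdd 6), (xa 1, Multiplicative.ofAdd 7),
      (xa 1, Multiplicative.ofAdd 8), (xa 1, Multiplicative.ofAdd 9), (xa 1, Multiplicative.ofAdd 10),
      (xa 1, Multiplicative.ofAdd 11), (xa 1, Multiplicative.ofAdd 12), (xa 2, Multiplicative.ofAdd 0),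
      (xa 2, Multiplicative.ofAdd 3), (xa 2, Multiplicative.ofAdd 5), (xa 3, Multiplicative.ofAdd 0),
      (xa 3, Multiplicative.ofAdd 1)}
    (by decide +kernel) (by decide +kernel)
    {(a 0, Multiplicative.ofAdd 1), (a 0, Multiplicative.ofAdd 4), (a 0, Multiplicative.ofAdd 6),
      (a 1, Multiplicative.ofAdd 2), (a 2, Multiplicative.ofAdd 0), (a 2, Multiplicative.ofAdd 3),
      (a 2, Multiplicative.ofAdd 5), (a 3, Multiplicative.ofAdd 0), (xa 0, Multiplicative.ofAdd 7),
      (xa 1, Multiplicative.ofAdd 1), (xa 1, Multiplicative.ofAdd 3), (xa 1, Multiplicative.ofAdd 6),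
      (xa 2, Multiplicative.ofAdd 5), (xa 3, Multiplicative.ofAdd 2), (xa 3, Multiplicative.ofAdd 4),
      (xa 3, Multiplicative.ofAdd 7)}
    (by decide +kernel) (by decide +kernel) (by decide +kernel)

end Summit.HodgeConjecture.CorCM.GaloisModels

end
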